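import Summits.QuantumFields.BalabanUV.Beta.GAN24.WilsonFaceGradedIdentity

/-!
# `BalabanUV.Beta.GAN24.WilsonEdgeCurrent` — binder row G-an2-4 ∕ (CONV-C), W-slot CT-W, the conservation law (C)∕(C)sym (hypothesis `hC` of
# `ThreeFaceRecClosed.exists_allScalesSeq_JsRowD1Pin_of_C_QD`; OWNER RULING R-gan24p1-g23-3 (ii)): **THE BIWEIGHTED CONTRACTION OF an3's CUBIC WILSON
# STENCIL IS A CURRENT** — for `γ ≠ α` and ARBITRARY weights `p q : ℤ → ℝ` of the slot's `γ`-coordinate and of the first leg's `α`-coordinate, the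
# `(inl α, inl b)`-block summed over the slot and the first leg is `[b = γ]·p(z_γ)·(q(z_α − 1) − q(z_α)) + [b = α]·q(z_α)·(p(z_γ) − p(z_γ − 1))`
# — minus the codifferential of the product 2-form `p ⊗ q` on the `(γ, α)`-plaquettes, read on the free second leg (generic `d`)

NOT IN PRINT; OUR BOOKKEEPING ([folklore] finite stencil algebra over an3's DEFINED tables `PlaquetteStencilData.wα ∕ wβ ∕ wm` read through leaf-15's register
`WilsonVertexSumZero` (`uv`, `wc`) and this lineage's `WilsonGradedBlockSums` §1 (family offsets ∕ entries) and `WilsonFaceGradedIdentity.sum_weighted_wilsonA` BY NAME;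
G-an2-4 formalisation swarm, leaf prover `b2b-balaban-gan24-formalise-leaf-04`, gen 64).  HONEST FRAMING (cell contract, verbatim): «discharging `BetaPertH` makes
Bałaban's UV stability UNCONDITIONAL — a real constructive-QFT result; it is NOT the continuum limit and NOT the Clay problem.»  HONEST DEPENDENCY (verbatim):
«continuum YM on T⁴ ⇐ BetaPertH ∧ nine spine estimates (0/9 proved); BetaPertH ⇐ (D1) ∧ (D4) ∧ CAP+tail; G-an2-4 gates asym, D1 and NE2/3/4.»

WHY (the located use; this lineage's note `HOME/b2b-balaban-gan24-formalise-leaf-04/g64/CSYM-D3-ANATOMY.md` §3 (c)): in the zero mode of ONE dressed second-order step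
with constant coarse test forms, the only surviving source word is the cubic × cubic Wilson EXCHANGE, whose half-vertex vector is the present contraction with
`p = q =` the exit-face indicators `𝟙[· ≡ −1 (mod Lc)]` (`Π_bm 1_α = Lc·𝟙_face`): then `p ⊗ q = 𝟙_{E(γ,α)}` (the column of `(γ,α)`-plaquettes along the block edge) and
the half-vertex is minus its boundary circulation — the located mechanism of (C) at level 0 («L²·u − (L²−1)·u = u»), kit j167031 ∕ j167153 (D = 2, 3).

MECHANISM (generic `d`; no `decide`, no numeral case bash): `sum_weighted_wilsonA` turns the box double sum into the two stencil sums (H1) `Σ_i p(−(wβ i)_γ)·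
q((wα i)_α − (wβ i)_α)·wc γ i α b` and (H2) `Σ_i p(−(wα i)_γ)·q((wβ i)_α − (wα i)_α)·wc γ i b α`; family by family: the CURRENT family gives
`[b = α]·q 0·(p 0 − p(−1))` to (H1) and its negative to (H2); the LONGITUDINAL family gives `[b = γ]·2·p 0·(q 0 − q(−1))` to (H2) and `0` to (H1); the SPIN family and the
three REMAINDER families (difference ∕ transport ∕ far-corner) give `0` to both (cancellation inside each `(ν, j)` group); `½((H1) − (H2))` is the claim.  In exact
arithmetic every family table agrees at `d+1 = 2, 3, 4` (this lineage's `g64/num/bilinear_fam.py` over g63's stencil mirror, DIAG only).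

WHAT ([folklore]; 0 `def`, 0 cited facts, 0 `def … : Prop`, 0 sorry; generic `d`): §1 per-family lemmas `h1_cur … h1_fa`, `h2_cur … h2_fa`, the totals `h1_total`,
`h2_total`; §2 **`sum_box1_biweighted_wilsonA`** (slot at `0`), **`sum_box1_biweighted_wilsonA_at`** (slot translates of a fixed second leg `z`) and its
antisymmetry under «background ↔ leg» **`sum_box1_biweighted_wilsonA_at_add_swap`**.  Asserts NO value of
Bałaban's tables beyond these finite identities of an3's defined stencil; discharges NOTHING of (C)sym ∕ (Q-D) ∕ (Q-D-rate) ∕ «T2Shape» ∕ «T2Drift» ∕ (hW, hWall) ∕ D1;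
NOT «D1 closed»; NEVER «G-an2-4 closed» as (CONV-C); NOT D1, NOT `BetaPertH`, NOT continuum, NOT Clay.  2026-08-22; no existing file touched.
-/

noncomputable section

open Finset
open scoped BigOperators
open Literature.MathematicalPhysics.QuantumFieldTheory.Balaban1983to89
open Literature.MathematicalPhysics.QuantumFieldTheory.Balaban1983to89.Beta
open B6BondElimination (unitVec unitVec_apply)
open PlaquetteStencilData (WilsonIdx RemIdx wα wβ wm fam trm dim bsm rmm dvm dvβ rmα rmβ bsα bsβ boff bd₁ bd₂ bsgn diα diβ trα trβ faα faβ)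
open PlaquetteStencil (dirBlock dirBlock_apply)
open GhostTable (curM copies curα curβ)
open SpinTable (spM spα spinMat spinMat_apply spinDir spinDir_apply)
open PlaquetteWeitzenbock (sTot)
open StepJetData (wilsonA wilsonA_translate)
open BalabanStepJets (box1)
open ExpKernelCalculus (shiftK)
open Summit.QuantumFields.BalabanUV.Beta.GAN24.WilsonVertexSumZero (uv wc)
open Summit.QuantumFields.BalabanUV.Beta.GAN24.WilsonGradedBlockSums (dirBlock_one_apply copies_one_apply spinMat_one_apply wα_cur wβ_cur wc_cur
  wα_spin wβ_spin wc_spin wα_div wβ_div wc_div wα_di wβ_di wc_di wα_tr wβ_tr wc_tr wα_fa wβ_fa wc_fa)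
open Summit.QuantumFields.BalabanUV.Beta.GAN24.WilsonFaceGradedIdentity (sum_weighted_wilsonA suppW_zero_subset_box1)

namespace Summit.QuantumFields.BalabanUV.Beta.GAN24.WilsonEdgeCurrent

variable {d : ℕ}

/-! ## §1 The two biweighted stencil sums, family by family -/

section Fam

variable {γ α : Fin (d + 1)} (hγα : γ ≠ α) (p q : ℤ → ℝ) (b : Fin (d + 1))
include hγα

/-! ### (H1): `Σ_i p(−(wβ i)_γ)·q((wα i)_α − (wβ i)_α)·wc γ i α b` -/

/-- [folklore] (H1), current family: `[b = α]·q 0·(p 0 − p(−1))`. -/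
theorem h1_cur : ∑ c : Bool, p (-(wβ uv γ (Sum.inl (Sum.inl (Sum.inl c)) : WilsonIdx (Fin (d + 1))) γ)) *
    q ((wα uv γ (Sum.inl (Sum.inl (Sum.inl c)) : WilsonIdx (Fin (d + 1))) α) - (wβ uv γ (Sum.inl (Sum.inl (Sum.inl c)) : WilsonIdx (Fin (d + 1))) α)) *
    wc γ (Sum.inl (Sum.inl (Sum.inl c))) α b = if b = α then q 0 * (p 0 - p (-1)) else 0 := by
  rw [Fintype.sum_bool]
  simp only [wα_cur, wβ_cur, wc_cur, if_true, Bool.false_eq_true, if_false, Pi.zero_apply, neg_zero, sub_zero, uv, unitVec_apply,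
    if_neg (Ne.symm hγα)]
  by_cases hb : b = α
  · subst hb; simp
    ring
  · simp [hb, Ne.symm hb]

/-- [folklore] (H1), spin family: `0`. -/
theorem h1_spin : ∑ pr : Fin (d + 1) × Bool, p (-(wβ uv γ (Sum.inl (Sum.inl (Sum.inr pr)) : WilsonIdx (Fin (d + 1))) γ)) *
    q ((wα uv γ (Sum.inl (Sum.inl (Sum.inr pr)) : WilsonIdx (Fin (d + 1))) α) - (wβ uv γ (Sum.inl (Sum.inl (Sum.inr pr)) : WilsonIdx (Fin (d + 1))) α)) *
    wc γ (Sum.inl (Sum.inl (Sum.inr pr))) α b = 0 := by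
  rw [Fintype.sum_prod_type]
  refine Finset.sum_eq_zero fun ν _ => ?_
  rw [Fintype.sum_bool]
  simp only [wα_spin, wβ_spin, wc_spin, sub_self]
  by_cases hν : ν = α
  · subst hν
    simp [uv, unitVec_apply, hγα]
    split_ifs <;> ring
  · simp [hν, hγα]

/-- [folklore] (H1), longitudinal family: `0` (every `(α, b)` entry of `± dirBlock γ ν` vanishes as `α ≠ γ`). -/
theorem h1_div : ∑ pr : Fin (d + 1) × Bool, p (-(wβ uv γ (Sum.inl (Sum.inr pr) : WilsonIdx (Fin (d + 1))) γ)) *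
    q ((wα uv γ (Sum.inl (Sum.inr pr) : WilsonIdx (Fin (d + 1))) α) - (wβ uv γ (Sum.inl (Sum.inr pr) : WilsonIdx (Fin (d + 1))) α)) *
    wc γ (Sum.inl (Sum.inr pr)) α b = 0 := by
  rw [Fintype.sum_prod_type]
  refine Finset.sum_eq_zero fun ν _ => ?_
  rw [Fintype.sum_bool]
  simp only [wc_div]
  simp [Ne.symm hγα]

/-- [folklore] (H1), difference family of the remainder vertex: `0`. -/
theorem h1_di : ∑ pr : Fin (d + 1) × (Fin 4 × Fin 12), p (-(wβ uv γ (Sum.inr (Sum.inl (Sum.inl pr)) : WilsonIdx (Fin (d + 1))) γ)) *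
    q ((wα uv γ (Sum.inr (Sum.inl (Sum.inl pr)) : WilsonIdx (Fin (d + 1))) α) - (wβ uv γ (Sum.inr (Sum.inl (Sum.inl pr)) : WilsonIdx (Fin (d + 1))) α)) *
    wc γ (Sum.inr (Sum.inl (Sum.inl pr))) α b = 0 := by
  rw [Fintype.sum_prod_type]
  refine Finset.sum_eq_zero fun ν _ => ?_
  rw [Fintype.sum_prod_type]
  simp only [Fin.sum_univ_succ, Fin.sum_univ_zero, wα_di, wβ_di, wc_di, bd₁, bd₂, bsgn, boff, diα, diβ, dim, Matrix.cons_val_zero,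
    Matrix.cons_val_succ, Matrix.smul_apply, Matrix.neg_apply, Pi.add_apply, Pi.neg_apply, Pi.zero_apply, dirBlock_one_apply,
    uv, unitVec_apply, smul_eq_mul]
  by_cases hν : ν = α
  · subst hν
    simp [hγα, hγα.symm]
    split_ifs <;> ring
  · by_cases hν' : ν = γ
    · subst hν'
      simp [hγα.symm]
    · simp [Ne.symm hν, Ne.symm hν', hγα.symm]

/-- [folklore] (H1), transport family: `0`. -/
theorem h1_tr : ∑ pr : Fin (d + 1) × (Fin 4 × Fin 8), p (-(wβ uv γ (Sum.inr (Sum.inl (Sum.inr pr)) : WilsonIdx (Fin (d + 1))) γ)) *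
    q ((wα uv γ (Sum.inr (Sum.inl (Sum.inr pr)) : WilsonIdx (Fin (d + 1))) α) - (wβ uv γ (Sum.inr (Sum.inl (Sum.inr pr)) : WilsonIdx (Fin (d + 1))) α)) *
    wc γ (Sum.inr (Sum.inl (Sum.inr pr))) α b = 0 := by
  rw [Fintype.sum_prod_type]
  refine Finset.sum_eq_zero fun ν _ => ?_
  rw [Fintype.sum_prod_type]
  simp only [Fin.sum_univ_succ, Fin.sum_univ_zero, wα_tr, wβ_tr, wc_tr, bd₁, bd₂, bsgn, boff, trα, trβ, trm, Matrix.cons_val_zero,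
    Matrix.cons_val_succ, Matrix.neg_apply, Pi.add_apply, Pi.neg_apply, Pi.zero_apply, dirBlock_one_apply, uv, unitVec_apply]
  by_cases hν : ν = α
  · subst hν
    simp [hγα, hγα.symm]
    split_ifs <;> ring
  · by_cases hν' : ν = γ
    · subst hν'
      simp [hγα.symm]
    · simp [Ne.symm hν, Ne.symm hν', hγα.symm]

/-- [folklore] (H1), far-corner family: `0`. -/
theorem h1_fa : ∑ pr : Fin (d + 1) × (Fin 4 × Bool), p (-(wβ uv γ (Sum.inr (Sum.inr pr) : WilsonIdx (Fin (d + 1))) γ)) *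
    q ((wα uv γ (Sum.inr (Sum.inr pr) : WilsonIdx (Fin (d + 1))) α) - (wβ uv γ (Sum.inr (Sum.inr pr) : WilsonIdx (Fin (d + 1))) α)) *
    wc γ (Sum.inr (Sum.inr pr)) α b = 0 := by
  rw [Fintype.sum_prod_type]
  refine Finset.sum_eq_zero fun ν _ => ?_
  rw [Fintype.sum_prod_type]
  simp only [Fin.sum_univ_succ, Fin.sum_univ_zero, Fintype.sum_bool, wα_fa, wβ_fa, wc_fa, bd₁, bd₂, bsgn, boff, faα, faβ, fam,
    Matrix.cons_val_zero, Matrix.cons_val_succ, Matrix.neg_apply, Pi.add_apply, Pi.neg_apply, Pi.zero_apply, dirBlock_one_apply, uv,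
    unitVec_apply, if_true, Bool.false_eq_true, if_false]
  by_cases hν : ν = α
  · subst hν
    simp [hγα, hγα.symm]
    split_ifs <;> ring
  · by_cases hν' : ν = γ
    · subst hν'
      simp [hγα.symm]
    · simp [Ne.symm hν, Ne.symm hν', hγα.symm]

/-- [folklore] **(H1) TOTAL**: `Σ_i p(−(wβ i)_γ)·q((wα i)_α − (wβ i)_α)·wc γ i α b = [b = α]·q 0·(p 0 − p(−1))`. -/
theorem h1_total : ∑ i : WilsonIdx (Fin (d + 1)), p (-(wβ uv γ i γ)) * q ((wα uv γ i) α - (wβ uv γ i) α) * wc γ i α b =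
    if b = α then q 0 * (p 0 - p (-1)) else 0 := by
  rw [Fintype.sum_sum_type, Fintype.sum_sum_type, Fintype.sum_sum_type, Fintype.sum_sum_type, Fintype.sum_sum_type,
    h1_cur hγα p q b, h1_spin hγα p q b, h1_div hγα p q b, h1_di hγα p q b, h1_tr hγα p q b, h1_fa hγα p q b]
  simp

/-! ### (H2): `Σ_i p(−(wα i)_γ)·q((wβ i)_α − (wα i)_α)·wc γ i b α` -/

/-- [folklore] (H2), current family: `[b = α]·q 0·(p(−1) − p 0)`. -/
theorem h2_cur : ∑ c : Bool, p (-(wα uv γ (Sum.inl (Sum.inl (Sum.inl c)) : WilsonIdx (Fin (d + 1))) γ)) *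
    q ((wβ uv γ (Sum.inl (Sum.inl (Sum.inl c)) : WilsonIdx (Fin (d + 1))) α) - (wα uv γ (Sum.inl (Sum.inl (Sum.inl c)) : WilsonIdx (Fin (d + 1))) α)) *
    wc γ (Sum.inl (Sum.inl (Sum.inl c))) b α = if b = α then q 0 * (p (-1) - p 0) else 0 := by
  rw [Fintype.sum_bool]
  simp only [wα_cur, wβ_cur, wc_cur, if_true, Bool.false_eq_true, if_false, Pi.zero_apply, neg_zero, sub_zero, uv, unitVec_apply,
    if_neg (Ne.symm hγα)]
  by_cases hb : b = α
  · subst hb; simp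
    ring
  · simp [hb]

/-- [folklore] (H2), spin family: `0`. -/
theorem h2_spin : ∑ pr : Fin (d + 1) × Bool, p (-(wα uv γ (Sum.inl (Sum.inl (Sum.inr pr)) : WilsonIdx (Fin (d + 1))) γ)) *
    q ((wβ uv γ (Sum.inl (Sum.inl (Sum.inr pr)) : WilsonIdx (Fin (d + 1))) α) - (wα uv γ (Sum.inl (Sum.inl (Sum.inr pr)) : WilsonIdx (Fin (d + 1))) α)) *
    wc γ (Sum.inl (Sum.inl (Sum.inr pr))) b α = 0 := by
  rw [Fintype.sum_prod_type]
  refine Finset.sum_eq_zero fun ν _ => ?_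
  rw [Fintype.sum_bool]
  simp only [wα_spin, wβ_spin, wc_spin, sub_self]
  by_cases hν : ν = α
  · subst hν
    simp [uv, unitVec_apply, hγα]
    split_ifs <;> ring
  · simp [hν, hγα]

/-- [folklore] (H2), longitudinal family: `[b = γ]·2·p 0·(q 0 − q(−1))` (only `ν = α` survives; its two columns sit at `α`-grades `0` and `−1`). -/
theorem h2_div : ∑ pr : Fin (d + 1) × Bool, p (-(wα uv γ (Sum.inl (Sum.inr pr) : WilsonIdx (Fin (d + 1))) γ)) *
    q ((wβ uv γ (Sum.inl (Sum.inr pr) : WilsonIdx (Fin (d + 1))) α) - (wα uv γ (Sum.inl (Sum.inr pr) : WilsonIdx (Fin (d + 1))) α)) *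
    wc γ (Sum.inl (Sum.inr pr)) b α = if b = γ then 2 * (p 0 * (q 0 - q (-1))) else 0 := by
  rw [Fintype.sum_prod_type]
  rw [Finset.sum_eq_single_of_mem α (Finset.mem_univ α)]
  · rw [Fintype.sum_bool]
    simp only [wα_div, wβ_div, wc_div, if_true, Bool.false_eq_true, if_false, Pi.zero_apply, Pi.sub_apply, neg_zero, sub_zero, uv, unitVec_apply,
      if_neg (Ne.symm hγα), and_true]
    by_cases hb : b = γ
    · subst hb; simp
      ring
    · simp [hb]
  · intro ν _ hν
    rw [Fintype.sum_bool]
    simp only [wc_div]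
    simp [Ne.symm hν]

/-- [folklore] (H2), difference family: `0`. -/
theorem h2_di : ∑ pr : Fin (d + 1) × (Fin 4 × Fin 12), p (-(wα uv γ (Sum.inr (Sum.inl (Sum.inl pr)) : WilsonIdx (Fin (d + 1))) γ)) *
    q ((wβ uv γ (Sum.inr (Sum.inl (Sum.inl pr)) : WilsonIdx (Fin (d + 1))) α) - (wα uv γ (Sum.inr (Sum.inl (Sum.inl pr)) : WilsonIdx (Fin (d + 1))) α)) *
    wc γ (Sum.inr (Sum.inl (Sum.inl pr))) b α = 0 := by
  rw [Fintype.sum_prod_type]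
  refine Finset.sum_eq_zero fun ν _ => ?_
  rw [Fintype.sum_prod_type]
  simp only [Fin.sum_univ_succ, Fin.sum_univ_zero, wα_di, wβ_di, wc_di, bd₁, bd₂, bsgn, boff, diα, diβ, dim, Matrix.cons_val_zero,
    Matrix.cons_val_succ, Matrix.smul_apply, Matrix.neg_apply, Pi.add_apply, Pi.neg_apply, Pi.zero_apply, dirBlock_one_apply,
    uv, unitVec_apply, smul_eq_mul]
  by_cases hν : ν = α
  · subst hν
    simp [hγα, hγα.symm]
  · by_cases hν' : ν = γ
    · subst hν'
      simp [hγα.symm]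
    · simp [Ne.symm hν, Ne.symm hν', hγα.symm]

/-- [folklore] (H2), transport family: `0`. -/
theorem h2_tr : ∑ pr : Fin (d + 1) × (Fin 4 × Fin 8), p (-(wα uv γ (Sum.inr (Sum.inl (Sum.inr pr)) : WilsonIdx (Fin (d + 1))) γ)) *
    q ((wβ uv γ (Sum.inr (Sum.inl (Sum.inr pr)) : WilsonIdx (Fin (d + 1))) α) - (wα uv γ (Sum.inr (Sum.inl (Sum.inr pr)) : WilsonIdx (Fin (d + 1))) α)) *
    wc γ (Sum.inr (Sum.inl (Sum.inr pr))) b α = 0 := by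
  rw [Fintype.sum_prod_type]
  refine Finset.sum_eq_zero fun ν _ => ?_
  rw [Fintype.sum_prod_type]
  simp only [Fin.sum_univ_succ, Fin.sum_univ_zero, wα_tr, wβ_tr, wc_tr, bd₁, bd₂, bsgn, boff, trα, trβ, trm, Matrix.cons_val_zero,
    Matrix.cons_val_succ, Matrix.neg_apply, Pi.add_apply, Pi.neg_apply, Pi.zero_apply, dirBlock_one_apply, uv, unitVec_apply]
  by_cases hν : ν = α
  · subst hν
    simp [hγα, hγα.symm]
  · by_cases hν' : ν = γ
    · subst hν'
      simp [hγα.symm]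
    · simp [Ne.symm hν, Ne.symm hν', hγα.symm]

/-- [folklore] (H2), far-corner family: `0`. -/
theorem h2_fa : ∑ pr : Fin (d + 1) × (Fin 4 × Bool), p (-(wα uv γ (Sum.inr (Sum.inr pr) : WilsonIdx (Fin (d + 1))) γ)) *
    q ((wβ uv γ (Sum.inr (Sum.inr pr) : WilsonIdx (Fin (d + 1))) α) - (wα uv γ (Sum.inr (Sum.inr pr) : WilsonIdx (Fin (d + 1))) α)) *
    wc γ (Sum.inr (Sum.inr pr)) b α = 0 := by
  rw [Fintype.sum_prod_type]
  refine Finset.sum_eq_zero fun ν _ => ?_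
  rw [Fintype.sum_prod_type]
  simp only [Fin.sum_univ_succ, Fin.sum_univ_zero, Fintype.sum_bool, wα_fa, wβ_fa, wc_fa, bd₁, bd₂, bsgn, boff, faα, faβ, fam,
    Matrix.cons_val_zero, Matrix.cons_val_succ, Matrix.neg_apply, Pi.add_apply, Pi.neg_apply, Pi.zero_apply, dirBlock_one_apply, uv,
    unitVec_apply, if_true, Bool.false_eq_true, if_false]
  by_cases hν : ν = α
  · subst hν
    simp [hγα, hγα.symm]
    split_ifs <;> ring
  · by_cases hν' : ν = γ
    · subst hν'
      simp [hγα.symm]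
    · simp [Ne.symm hν, Ne.symm hν', hγα.symm]

/-- [folklore] **(H2) TOTAL**: `Σ_i p(−(wα i)_γ)·q((wβ i)_α − (wα i)_α)·wc γ i b α = [b = α]·q 0·(p(−1) − p 0) + [b = γ]·2·p 0·(q 0 − q(−1))`. -/
theorem h2_total : ∑ i : WilsonIdx (Fin (d + 1)), p (-(wα uv γ i γ)) * q ((wβ uv γ i) α - (wα uv γ i) α) * wc γ i b α =
    (if b = α then q 0 * (p (-1) - p 0) else 0) + (if b = γ then 2 * (p 0 * (q 0 - q (-1))) else 0) := by
  rw [Fintype.sum_sum_type, Fintype.sum_sum_type, Fintype.sum_sum_type, Fintype.sum_sum_type, Fintype.sum_sum_type,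
    h2_cur hγα p q b, h2_spin hγα p q b, h2_div hγα p q b, h2_di hγα p q b, h2_tr hγα p q b, h2_fa hγα p q b]
  simp

end Fam

/-! ## §2 The biweighted box sum of the antisymmetrised table is the current `−d*(p ⊗ q)` -/

section Current

variable {γ α : Fin (d + 1)} (hγα : γ ≠ α)
include hγα

/-- [folklore] **THE BIWEIGHTED CONTRACTION OF THE CUBIC WILSON TABLE IS A CURRENT** (slot at `0`; generic `d`; `γ ≠ α`; every `p q : ℤ → ℝ`; every
second-leg component `b`): weighting the slot by `p` of (minus) the second leg's `γ`-offset and the first leg by `q` of the `α`-offset difference,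
`Σ_{x,z ∈ box1} p(−z_γ)·q(x_α − z_α)·wilsonA d γ 0 x z (inl α) (inl b) = [b = γ]·p 0·(q(−1) − q 0) + [b = α]·q 0·(p 0 − p(−1))`. -/
theorem sum_box1_biweighted_wilsonA (p q : ℤ → ℝ) (b : Fin (d + 1)) :
    ∑ x ∈ box1 (d + 1), ∑ z ∈ box1 (d + 1), p (-(z γ)) * q (x α - z α) * wilsonA d γ 0 x z (Sum.inl α) (Sum.inl b) =
      (if b = γ then p 0 * (q (-1) - q 0) else 0) + (if b = α then q 0 * (p 0 - p (-1)) else 0) := by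
  have h := sum_weighted_wilsonA γ 0 α b (box1 (d + 1)) (suppW_zero_subset_box1 γ) (fun x z => p (-(z γ)) * q (x α - z α))
  simp only [zero_add] at h
  rw [h, h1_total hγα p q b, h2_total hγα p q b]
  have hbb : ¬(b = γ ∧ b = α) := fun hh => hγα (hh.1.symm.trans hh.2)
  by_cases hbγ : b = γ
  · have hbα : b ≠ α := fun h' => hbb ⟨hbγ, h'⟩
    simp only [hbγ, if_true, if_neg (hbγ ▸ hbα : γ ≠ α)]
    ring
  · by_cases hbα : b = α
    · simp only [hbα, if_true, if_neg (hbα ▸ hbγ : ¬ α = γ)]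
      ring
    · simp only [hbγ, hbα, if_false]
      ring


/-- [folklore] **THE SAME WITH THE SECOND LEG AT A GENERAL SITE `z`** (slot and first leg summed over their translated boxes `z − box1`, `z − w + box1`): for
`γ ≠ α`, all `p q : ℤ → ℝ`, every `b` and every `z`,
`Σ_{x,w ∈ box1} p((z−w)_γ)·q((z−w+x)_α)·wilsonA d γ (z−w) (z−w+x) z (inl α) (inl b) = [b = γ]·p(z_γ)·(q(z_α − 1) − q(z_α)) + [b = α]·q(z_α)·(p(z_γ) − p(z_γ − 1))`
— with `p = q = 𝟙[· ≡ −1 (mod Lc)]` the right side is minus the boundary circulation of the indicator of the `(γ, α)`-plaquettes along the block edge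
`{z_γ ≡ z_α ≡ −1}`, read on the bond `(z, b)` (`wilsonA_translate` + §2 at the shifted weights). -/
theorem sum_box1_biweighted_wilsonA_at (p q : ℤ → ℝ) (b : Fin (d + 1)) (z : Fin (d + 1) → ℤ) :
    ∑ x ∈ box1 (d + 1), ∑ w ∈ box1 (d + 1), p ((z - w) γ) * q ((z - w + x) α) * wilsonA d γ (z - w) (z - w + x) z (Sum.inl α) (Sum.inl b) =
      (if b = γ then p (z γ) * (q (z α - 1) - q (z α)) else 0) + (if b = α then q (z α) * (p (z γ) - p (z γ - 1)) else 0) := by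
  have key := sum_box1_biweighted_wilsonA hγα (fun t => p (z γ + t)) (fun t => q (z α + t)) b
  have e : ∀ x w : Fin (d + 1) → ℤ,
      wilsonA d γ (z - w) (z - w + x) z (Sum.inl α) (Sum.inl b) = wilsonA d γ 0 x w (Sum.inl α) (Sum.inl b) := by
    intro x w
    have h := wilsonA_translate (d := d) γ 0 (z - w)
    rw [zero_add] at h
    rw [h]
    show wilsonA d γ 0 (z - w + x + -(z - w)) (z + -(z - w)) (Sum.inl α) (Sum.inl b) = _
    congr 1
    · abel
    · abel
  have ep : ∀ x w : Fin (d + 1) → ℤ, p ((z - w) γ) * q ((z - w + x) α) = p (z γ + -(w γ)) * q (z α + (x α - w α)) := by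
    intro x w
    simp only [Pi.sub_apply, Pi.add_apply]
    rw [show z γ - w γ = z γ + -(w γ) from sub_eq_add_neg _ _, show z α - w α + x α = z α + (x α - w α) by ring]
  simp_rw [e, ep]
  rw [key]
  simp only [add_zero, ← sub_eq_add_neg]

/-- [folklore] **THE EDGE CURRENT IS ANTISYMMETRIC UNDER THE EXCHANGE OF BACKGROUND AND LEG** (`γ ≠ α`; all `p q`, every `b`, every second leg `z`): the
contraction with the slot along `γ` weighted by `p` and the first leg along `α` weighted by `q`, PLUS the contraction with the roles exchanged (slot along
`α` weighted by `q`, first leg along `γ` weighted by `p`), is `0` — both are the boundary circulation of the same column of plaquettes `p ⊗ q`, read with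
opposite orientations.  WHY (note §7): the «response» word of the one-step zero mode is SYMMETRIC in the two background insertions `(μ, ν)` while its
source current `E(f_ν) f_μ` is this antisymmetric pairing — so the response sector of the dressed step vanishes identically (kit j167031 ∕ j168341 ∕
j168345: `|RESP| ≤ 4·10⁻¹⁷`, D = 2, 3, L = 3, 5, 9), the diagonal `μ = ν` being the sibling `WilsonEdgeCurrentDiag`. -/
theorem sum_box1_biweighted_wilsonA_at_add_swap (p q : ℤ → ℝ) (b : Fin (d + 1)) (z : Fin (d + 1) → ℤ) :
    (∑ x ∈ box1 (d + 1), ∑ w ∈ box1 (d + 1), p ((z - w) γ) * q ((z - w + x) α) * wilsonA d γ (z - w) (z - w + x) z (Sum.inl α) (Sum.inl b)) +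
      ∑ x ∈ box1 (d + 1), ∑ w ∈ box1 (d + 1), q ((z - w) α) * p ((z - w + x) γ) * wilsonA d α (z - w) (z - w + x) z (Sum.inl γ) (Sum.inl b) = 0 := by
  rw [sum_box1_biweighted_wilsonA_at hγα p q b z, sum_box1_biweighted_wilsonA_at (Ne.symm hγα) q p b z]
  have hbb : ¬(b = γ ∧ b = α) := fun hh => hγα (hh.1.symm.trans hh.2)
  by_cases hbγ : b = γ
  · have hbα : b ≠ α := fun h' => hbb ⟨hbγ, h'⟩
    simp only [hbγ, if_true, if_neg (hbγ ▸ hbα : γ ≠ α)]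
    ring
  · by_cases hbα : b = α
    · simp only [hbα, if_true, if_neg (hbα ▸ hbγ : ¬ α = γ)]
      ring
    · simp only [hbγ, hbα, if_false]
      ring

end Current

end Summit.QuantumFields.BalabanUV.Beta.GAN24.WilsonEdgeCurrent

end
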